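import Literature.NumberTheory.GaloisRepresentations.PotentialDiagonalizabilityCriteria
import Literature.NumberTheory.GaloisRepresentations.LabelledHodgeTateWeights
import Literature.NumberTheory.GaloisRepresentations.FramedRepBlockSum
import Mathlib.RingTheory.RootsOfUnity.PrimitiveRoots
import HarnessLib

/-!
# Potential diagonalizability in the Fontaine–Laffaille range (BLGGT 2014, Lemma 1.4.3 (2)) and
# the `⊕` / restriction calculus of `~` (BLGGT §1.4, remarks (4), (5))

Companion of `PotentialDiagonalizability.lean` / `PotentialDiagonalizabilityCriteria.lean` (cite item
wi-39792, wanted by line `inert-fl-transfer` of crux `stmt-Langlands-17003`, stubs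
`stub_inductionUnramifiedFL` / `stub_tensorUnramifiedFL`).  The criteria file vendors Lemma 1.4.3 (1)
and records that "(2) needs the `p`-adic notion '`K/ℚ_p` unramified' and LABELLED Hodge–Tate weights";
labelled weights have since landed (`LabelledHodgeTateWeights.lean`,
`PeriodRingData.labelledHodgeTateWeights 𝔅 ρ τ`), and "`K/ℚ_p` unramified" is defined here
(`IsAbsolutelyUnramified`, valuation-free).  Everything is relative to crystalline extension data
`𝔅 : CrystallineExtensionData p K`, exactly as the accepted `blggt2014_lemma_1_4_3_1`.

## What is printed (held: arXiv:1010.2561, §1.4 "Local theory: `l = p`", pp. 14–15)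

* Remarks after the definition of `~` ("We make the following remarks."): "(4) If `K'/K` is a finite
  extension and `ρ₁ ~ ρ₂` then `ρ₁|_{G_{K'}} ~ ρ₂|_{G_{K'}}`.  (5) If `ρ₁ ~ ρ₂` and `ρ₁' ~ ρ₂'` then
  `ρ₁ ⊕ ρ₁' ~ ρ₂ ⊕ ρ₂'` and `ρ₁ ⊗ ρ₁' ~ ρ₂ ⊗ ρ₂'` and `ρ₁^∨ ~ ρ₂^∨`."
* **Lemma 1.4.3.** "Keep the above notation, including the assumption `l = p` [`K/ℚ_l` finite].
  Suppose that `ρ : G_K → GL_n(ℚ̄_l)` is a potentially crystalline representation. …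
  (2) If `K/ℚ_l` is unramified, if `ρ` is crystalline and if for each `τ : K ↪ L̄` the Hodge–Tate
  numbers `HT_τ(ρ) ⊂ [a_τ, a_τ + l − 2]` for some integer `a_τ`, then `ρ` is potentially
  diagonalizable."  Proof: twist to `a_τ = 0`; over a finite unramified `K'/K` with
  `ρ̄(G_{K'}) = ρ̄(I_K)`, `ρ̄|_{G_{K'}}` has an invariant filtration with one-dimensional graded pieces,
  Lemma 1.4.2 (Fontaine–Laffaille) gives a crystalline lift `ρ₂` with the same Hodge–Tate numbers and
  such a filtration, `ρ|_{G_{K'}} ~ ρ₂` by [CHT] Lemma 2.4.1, and `ρ₂` is potentially diagonalizable by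
  part (1).

## Rendering

* `IsAbsolutelyUnramified p K`: `K = ℚ_p(ζ)` for a root of unity `ζ` of order prime to `p` — for
  `K/ℚ_p` finite this IS "`K/ℚ_p` unramified" (`e(K/ℚ_p) = 1`): the unramified extensions of `ℚ_p` are
  exactly the `ℚ_p(μ_m)`, `p ∤ m` (an unramified `K` of degree `f` is `ℚ_p(μ_{p^f − 1})` by the
  Teichmüller lift; conversely `ℚ_p(ζ_m)/ℚ_p`, `p ∤ m`, is unramified) [Serre, *Local Fields*, IV §4,
  Prop. 16 and Cor. 1–2; Neukirch, *Algebraic Number Theory*, II (7.12)–(7.13)].  No valuation on `K`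
  is needed (the abstract `K` of these files carries none).
* Hodge–Tate labels: BLGGT's `τ : K ↪ ℚ̄_p` are rendered as the labels the crystalline datum of the
  base field offers, `τ : F₀ →+* ℚ̄_p` for `F₀ = (𝔅 ⊥).F₀` (the invariant field of the datum; for the
  intended `B_cris(K)` with `K` unramified, `F₀ = K₀ = K` and the filtration jumps of
  `D_cris(ρ) = D_dR(ρ)` are the Hodge–Tate numbers), and `HT_τ(ρ)` is
  `PeriodRingData.labelledHodgeTateWeights` of the `ℚ̄_p`-linear `ρ|_{Γ_⊥}` (`⊥ ≃ K`, the base-field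
  convention of `PotentialDiagonalizability.lean`).
* "`ρ` is crystalline": `IsCrystallineFn (𝔅 ⊥) (ρ|_{Γ_⊥}).matrixFn` (as in `IsDiagonalizable`).
* Item (5): `⊕` is the tree's `FramedGaloisRep.blockSum`; the `⊗` and `∨` clauses are NOT vendored
  (`-- TODO(general form)`: no Kronecker product of framed representations in the tree yet; `∨` not
  requested).  Item (4) in the base form `K' / K` (from `Connects` to `ConnectsOver … K'`).

## Main statements

* `IsAbsolutelyUnramified p K` (definition) with `isAbsolutelyUnramified_padic` (PROVED: `ℚ_p/ℚ_p`).
* `HasLabelledHodgeTateWeightsInFLRange 𝔅 ρ` (definition: the hypothesis of (2), an interval of length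
  `p − 2` for every label) with `hasLabelledHodgeTateWeightsInFLRange_iff`.
* `blggt2014_lemma_1_4_3_2` — NAMED FACT, Lemma 1.4.3 (2).
* `blggt2014_connects_restrict` — NAMED FACT, §1.4 remark (4) (base form).
* `blggt2014_connects_blockSum` — NAMED FACT, §1.4 remark (5), `⊕` clause.

## References

* T. Barnet-Lamb, T. Gee, D. Geraghty, R. Taylor, *Potential automorphy and change of weight*,
  Ann. of Math. 179 (2014) 501–609, §1.4 remarks (4)–(5), Lemma 1.4.3 (2) (arXiv:1010.2561
  pp. 14–15). [BarnetlambEtAl2014]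
* J.-P. Serre, *Local Fields*, GTM 67 (1979), Ch. IV §4, Prop. 16 and Cor. 1–2 (unramified
  extensions of `ℚ_p` are the cyclotomic ones of order prime to `p`). [Serre1979]
-/

noncomputable section

open Field

namespace Literature.NumberTheory.GaloisRepresentations

universe u w

/-! ### `K/ℚ_p` unramified, valuation-free -/

section Unramified

/-- **`K/ℚ_p` is (absolutely) unramified**: `K` is generated over `ℚ_p` by a root of unity of order
prime to `p`, `K = ℚ_p(ζ)`, `ζ^m = 1`, `p ∤ m`.  For `K/ℚ_p` finite this is equivalent to
`e(K/ℚ_p) = 1` (the unramified extensions of `ℚ_p` are exactly the `ℚ_p(μ_m)` with `p ∤ m`: Serre,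
*Local Fields*, IV §4; Neukirch II (7.12)–(7.13)); stated this way because the abstract `p`-adic
fields of `PotentialDiagonalizability.lean` carry no valuation. [cite: Serre1979, Ch. IV §4 (Prop. 16, Cor. 1–2)] -/
def IsAbsolutelyUnramified (p : ℕ) [Fact p.Prime] (K : Type u) [Field K] [Algebra ℚ_[p] K] : Prop :=
  ∃ (m : ℕ) (ζ : K), 0 < m ∧ ¬ p ∣ m ∧ ζ ^ m = 1 ∧ Algebra.adjoin ℚ_[p] {ζ} = ⊤

/-- Unfolding lemma. [folklore] -/
theorem isAbsolutelyUnramified_iff {p : ℕ} [Fact p.Prime] {K : Type u} [Field K] [Algebra ℚ_[p] K] :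
    IsAbsolutelyUnramified p K ↔
      ∃ (m : ℕ) (ζ : K), 0 < m ∧ ¬ p ∣ m ∧ ζ ^ m = 1 ∧ Algebra.adjoin ℚ_[p] {ζ} = ⊤ :=
  Iff.rfl

/-- `ℚ_p / ℚ_p` is unramified (`ζ = 1`, `m = 1`). [folklore] -/
theorem isAbsolutelyUnramified_padic (p : ℕ) [Fact p.Prime] : IsAbsolutelyUnramified p ℚ_[p] :=
  ⟨1, 1, one_pos, fun h => (Fact.out : p.Prime).one_lt.ne' (Nat.dvd_one.1 h), one_pow 1, by
    rw [Algebra.adjoin_singleton_one]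
    exact Algebra.eq_top_iff.2 fun x => ⟨x, rfl⟩⟩

end Unramified

/-! ### The Fontaine–Laffaille range hypothesis -/

section FLRange

variable {p : ℕ} [Fact p.Prime] {K : Type u} [Field K] [Algebra ℚ_[p] K] {n : ℕ}

/-- **`HT_τ(ρ) ⊂ [a_τ, a_τ + p − 2]` for every label `τ`** (the hypothesis of BLGGT Lemma 1.4.3 (2)):
for every embedding `τ : F₀ →+* ℚ̄_p` of the invariant field `F₀` of the base crystalline datum `𝔅 ⊥`
(intended: `F₀ = K`, `K/ℚ_p` unramified) there is an integer `a_τ` with every `τ`-labelled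
Hodge–Tate weight of the `ℚ̄_p`-linear `ρ|_{Γ_⊥}` (`PeriodRingData.labelledHodgeTateWeights`, computed
from the filtration of the datum) in `[a_τ, a_τ + p − 2]`. [cite: BarnetlambEtAl2014, §1.4 Lemma 1.4.3 (2)] -/
def HasLabelledHodgeTateWeightsInFLRange (𝔅 : CrystallineExtensionData.{u, w} p K)
    (ρ : FramedGaloisRep K (PadicAlgCl p) n) : Prop :=
  ∀ τ : (𝔅 ⊥ inferInstance).F₀ →+* PadicAlgCl p, ∃ a : ℤ,
    ∀ h ∈ (𝔅 ⊥ inferInstance).toPeriodRingData.labelledHodgeTateWeights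
        (ρ.restrictField (⊥ : IntermediateField K (AlgebraicClosure K))).toGaloisRep τ,
      a ≤ h ∧ h ≤ a + (p - 2 : ℕ)

/-- Unfolding lemma. [folklore] -/
theorem hasLabelledHodgeTateWeightsInFLRange_iff (𝔅 : CrystallineExtensionData.{u, w} p K)
    (ρ : FramedGaloisRep K (PadicAlgCl p) n) :
    HasLabelledHodgeTateWeightsInFLRange 𝔅 ρ ↔
      ∀ τ : (𝔅 ⊥ inferInstance).F₀ →+* PadicAlgCl p, ∃ a : ℤ,
        ∀ h ∈ (𝔅 ⊥ inferInstance).toPeriodRingData.labelledHodgeTateWeights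
            (ρ.restrictField (⊥ : IntermediateField K (AlgebraicClosure K))).toGaloisRep τ,
          a ≤ h ∧ h ≤ a + (p - 2 : ℕ) :=
  Iff.rfl

end FLRange

/-! ### The named facts -/

/-- **Barnet-Lamb–Gee–Geraghty–Taylor 2014, Lemma 1.4.3 (2)** — "If `K/ℚ_l` is unramified, if `ρ` is
crystalline and if for each `τ : K ↪ L̄` the Hodge–Tate numbers `HT_τ(ρ) ⊂ [a_τ, a_τ + l − 2]` for some
integer `a_τ`, then `ρ` is potentially diagonalizable" (`l = p`, `K/ℚ_p` finite,
`ρ : G_K → GL_n(ℚ̄_p)` continuous).  Tree rendering, relative to crystalline extension data `𝔅` for `K`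
(as `blggt2014_lemma_1_4_3_1`): `K/ℚ_p` finite and unramified (`IsAbsolutelyUnramified`), `ρ`
crystalline over `K` (`IsCrystallineFn (𝔅 ⊥) (ρ|_{Γ_⊥}).matrixFn`) with labelled Hodge–Tate weights in
Fontaine–Laffaille range (`HasLabelledHodgeTateWeightsInFLRange`) ⟹ `IsPotentiallyDiagonalizable 𝔅 ρ`.
Named fact (D-0014), not proved here (printed proof: Fontaine–Laffaille lift over an unramified `K'`
trivialising `ρ̄` on `G_{K'}/I_K`, [CHT] Lemma 2.4.1, and part (1)).
[cite: BarnetlambEtAl2014, §1.4 Lemma 1.4.3 (2)] -/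
def blggt2014_lemma_1_4_3_2 : Prop :=
  ∀ (p : ℕ) [Fact p.Prime] (K : Type) [Field K] [Algebra ℚ_[p] K] [FiniteDimensional ℚ_[p] K]
    (𝔅 : CrystallineExtensionData.{0, w} p K) (n : ℕ) (ρ : FramedGaloisRep K (PadicAlgCl p) n),
    IsAbsolutelyUnramified p K →
    IsCrystallineFn (𝔅 ⊥ inferInstance)
      (ρ.restrictField (⊥ : IntermediateField K (AlgebraicClosure K))).matrixFn →
    HasLabelledHodgeTateWeightsInFLRange 𝔅 ρ →
      IsPotentiallyDiagonalizable 𝔅 ρ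

/-- **BLGGT §1.4, remark (4) (base form)** — "If `K'/K` is a finite extension and `ρ₁ ~ ρ₂` then
`ρ₁|_{G_{K'}} ~ ρ₂|_{G_{K'}}`": for continuous `ρ₁ ρ₂ : Γ_K → GL_n(ℚ̄_p)` with `Connects 𝔅 ρ₁ ρ₂` and a
finite extension `K'` of `K` inside `K̄`, `ConnectsOver 𝔅 K' ρ₁|_{Γ_{K'}} ρ₂|_{Γ_{K'}}`.  Named fact
(D-0014). [cite: BarnetlambEtAl2014, §1.4 remark (4)] -/
def blggt2014_connects_restrict : Prop :=
  ∀ (p : ℕ) [Fact p.Prime] (K : Type) [Field K] [Algebra ℚ_[p] K] [FiniteDimensional ℚ_[p] K]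
    (𝔅 : CrystallineExtensionData.{0, w} p K) (n : ℕ) (ρ₁ ρ₂ : FramedGaloisRep K (PadicAlgCl p) n),
    Connects 𝔅 ρ₁ ρ₂ →
    ∀ (K' : IntermediateField K (AlgebraicClosure K)), FiniteDimensional K K' →
      ConnectsOver 𝔅 K' (ρ₁.restrictField K') (ρ₂.restrictField K')

/-- **BLGGT §1.4, remark (5), direct sums** — "If `ρ₁ ~ ρ₂` and `ρ₁' ~ ρ₂'` then
`ρ₁ ⊕ ρ₁' ~ ρ₂ ⊕ ρ₂'`": for a finite extension `K'` of `K` inside `K̄` and continuous representations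
`ρ₁ ρ₂ : Γ_{K'} → GL_m(ℚ̄_p)`, `ρ₁' ρ₂' : Γ_{K'} → GL_n(ℚ̄_p)`, `ConnectsOver 𝔅 K' ρ₁ ρ₂` and
`ConnectsOver 𝔅 K' ρ₁' ρ₂'` give `ConnectsOver 𝔅 K' (ρ₁ ⊞ ρ₁') (ρ₂ ⊞ ρ₂')` (`FramedGaloisRep.blockSum`,
the direct sum in the concatenated frame).  Named fact (D-0014).
`-- TODO(general form): the ⊗ and ∨ clauses of remark (5) (no Kronecker product of framed representations yet).`
[cite: BarnetlambEtAl2014, §1.4 remark (5)] -/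
def blggt2014_connects_blockSum : Prop :=
  ∀ (p : ℕ) [Fact p.Prime] (K : Type) [Field K] [Algebra ℚ_[p] K] [FiniteDimensional ℚ_[p] K]
    (𝔅 : CrystallineExtensionData.{0, w} p K) (K' : IntermediateField K (AlgebraicClosure K))
    (m n : ℕ) (ρ₁ ρ₂ : FramedGaloisRep K' (PadicAlgCl p) m) (ρ₁' ρ₂' : FramedGaloisRep K' (PadicAlgCl p) n),
    ConnectsOver 𝔅 K' ρ₁ ρ₂ → ConnectsOver 𝔅 K' ρ₁' ρ₂' →
      ConnectsOver 𝔅 K' (ρ₁.blockSum ρ₁') (ρ₂.blockSum ρ₂')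

/-- Remark (5) for representations of `Γ_K` itself (`Connects`, base field `⊥`), using that
restriction commutes with block sums (`FramedGaloisRep.restrictField_blockSum`).
[cite: BarnetlambEtAl2014, §1.4 remark (5)] -/
theorem blggt2014_connects_blockSum.connects (h : blggt2014_connects_blockSum.{w})
    {p : ℕ} [Fact p.Prime] {K : Type} [Field K] [Algebra ℚ_[p] K] [FiniteDimensional ℚ_[p] K]
    (𝔅 : CrystallineExtensionData.{0, w} p K) {m n : ℕ}
    {ρ₁ ρ₂ : FramedGaloisRep K (PadicAlgCl p) m} {ρ₁' ρ₂' : FramedGaloisRep K (PadicAlgCl p) n}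
    (h₁ : Connects 𝔅 ρ₁ ρ₂) (h₂ : Connects 𝔅 ρ₁' ρ₂') :
    Connects 𝔅 (ρ₁.blockSum ρ₁') (ρ₂.blockSum ρ₂') := by
  unfold Connects
  rw [FramedGaloisRep.restrictField_blockSum, FramedGaloisRep.restrictField_blockSum]
  exact h p K 𝔅 ⊥ m n _ _ _ _ h₁ h₂

end Literature.NumberTheory.GaloisRepresentations

end
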